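import Summits.QuantumFields.YangMills.Theorems.CovariantDischargeLatticeFormsDeg23
import Literature.MathematicalPhysics.QuantumFieldTheory.CubicalChainsHodge
import HarnessLib

/-!
# Line «sandwich_discharge» on crux `HistoryTailL` (stmt-QuantumFields-19936), stub `stub_sandwichSweepGapCapped` (S′), brick B5 on `ℤ³` —
# (Z-a′) «THE (Z-a) LETTERS ARE THE LITERATURE OPERATORS»: the free-symbol letters of ✓`CovariantDischargeLatticeFormsDeg23` (`d₀ d₁ d₂ δ₁ δ₂ δ₃ −Δ`
# as pointwise defining hypotheses over lit `B4Eq19LatticeOperators.Zd∕unitVec`) ARE lit ✓`LatticeForm.d₀∕d₁∕d₂` (`CubicalCochains`) and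
# lit ✓`LatticeChain.div₂∕div₃∕negLap₂` (`CubicalChainsHodge`) on `Site d = Zd d`, `e = unitVec`; and (Z-a)'s `hodge_two` ∕ `dTwo_curl_eq_zero` are
# RE-DERIVED from lit ✓`LatticeChain.div₃_d₂_add_d₁_div₂` ∕ ✓`LatticeForm.d₂_d₁` (one source of truth)

Cell `ym3-torus` (YM ladder rung R3 = continuum SU(2) Yang–Mills on the three-torus — a RUNG, NOT the Clay problem: not d = 4, not infinite volume,
not a mass gap); WIDTH helper seat `ym3-torus-px6` gen 8; `--supports stmt-QuantumFields-19936` (helper).  THEOREMS ONLY (0 `def`, default heartbeats).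

WHY (my 11:03:55Z prior-art disclosure on (Z-a); ★★OWNER g30 11:07:29Z (2) «one source of truth … the gate's dedup cannot see free-symbol twins, humans
can»; w8 g8 11:04:08Z sequencing «bridge WELCOME, NOT GATING»).  (Z-a) was typed in FREE-SYMBOL form so the B5 knit ((Z-b)∕(Z-e), px8 g7) instantiates
its identities by `rfl`; the same cubical calculus exists in the Literature as DEFINED operators over an abelian group (Forsström–Lenells–Viklund ∕
Fröhlich–Spencer conventions), proved there: `d ∘ d = 0` (✓`LatticeForm.d₁_d₀`, ✓`d₂_d₁`) and the degree-two Hodge identity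
(✓`LatticeChain.div₃_d₂_add_d₁_div₂ : div₃ (d₂ M) + d₁ (div₂ M) = negLap₂ M`).  THIS FILE records, for real-valued forms:
* §1 the DICTIONARY, pointwise: `LatticeForm.e = unitVec`; `d₀ f`, `d₁ a`, `d₂ F`, `div₂ F`, `div₃ H`, `negLap₂ F` EQUAL (Z-a)'s letters (`rfl` up to `ring`
  inside the `κ`-sum) — so every (Z-a)∕(Z-b)∕(Z-e) hypothesis `hda`∕`hdF`∕`hδF`∕`hδH`∕`hΔ` is DISCHARGED by the lit operator (`d₁_letter`, `d₂_letter`, …);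
* §2 CONSISTENCY BY KERNEL: (Z-a)'s `hodge_two` at `δF := div₂ F`, `dF := d₂ F` IS lit's `div₃_d₂_add_d₁_div₂` evaluated at `(x,μ,ν)` (`hodge_two_eq_lit`, both
  directions), and (Z-a)'s `dTwo_curl_eq_zero` at `F := d₁ a` IS lit's `d₂_d₁` (`dTwo_curl_eq_zero_eq_lit`);
* §3 the lit operators satisfy (Z-a)'s NEW rows verbatim: adjointness `Σ (div₃ ψ)·F = Σ ψ·∇F` on a box and the bulk-term vanishing for `d₂`-closed `F`
  (`sum_div₃_mul_of_support`, `sum_div₃_mul_eq_zero_of_d₂_eq_zero`) — the rows `CubicalChainsHodge` says are «not proved in this file».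
HONEST SCOPE: a dictionary and two consistency checks; no new mathematics; NOTHING here proves B5, the capped stub, `HistoryTailL`, or any summit statement;
YM₃ on T³ is rung R3, not Clay. [folklore]
-/

noncomputable section

open scoped BigOperators
open Finset

namespace Summit.QuantumFields.YangMills.Theorems.CovariantDischargeLatticeFormsBridge

open Literature.MathematicalPhysics.QuantumFieldTheory.Balaban1983to89.B4Eq19LatticeOperators (Zd unitVec box)
open Literature.MathematicalPhysics.QuantumFieldTheory.LatticeForm (d₀ d₁ d₂)
open Literature.MathematicalPhysics.QuantumFieldTheory.LatticeChain (div₂ div₃ negLap₂)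
open Summit.QuantumFields.YangMills.Theorems.CovariantDischargeLatticeFormsDeg23

variable {d : ℕ}

/-! ## §1 The dictionary -/

/-- `LatticeForm.e i = B4Eq19LatticeOperators.unitVec i` (both `Pi.single i 1` on `Fin d → ℤ`). [folklore] -/
theorem e_eq_unitVec (i : Fin d) : (Literature.MathematicalPhysics.QuantumFieldTheory.LatticeForm.e i : Zd d) = unitVec i := rfl

/-- lit `d₀` IS (Z-a)'s `d₀` letter. [folklore] -/
theorem d₀_letter (f : Zd d → ℝ) (x : Zd d) (μ : Fin d) : d₀ f x μ = f (x + unitVec μ) - f x := rfl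

/-- lit `d₁` IS (Z-a)'s `d₁` letter (`θ x i + θ (x+eᵢ) j − θ (x+eⱼ) i − θ x j` rearranged). [folklore] -/
theorem d₁_letter (a : Zd d → Fin d → ℝ) (x : Zd d) (μ ν : Fin d) :
    d₁ a x μ ν = (a (x + unitVec μ) ν - a x ν) - (a (x + unitVec ν) μ - a x μ) := by
  show a x μ + a (x + unitVec μ) ν - a (x + unitVec ν) μ - a x ν = _
  ring

/-- lit `d₂` IS (Z-a)'s ALTERNATING `d₂` letter, on the nose. [folklore] -/
theorem d₂_letter (F : Zd d → Fin d → Fin d → ℝ) (x : Zd d) (κ μ ν : Fin d) :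
    d₂ F x κ μ ν = (F (x + unitVec κ) μ ν - F x μ ν) - (F (x + unitVec μ) κ ν - F x κ ν) + (F (x + unitVec ν) κ μ - F x κ μ) := rfl

/-- lit `div₂` IS (Z-a)'s `δ₂` letter, on the nose. [folklore] -/
theorem div₂_letter (F : Zd d → Fin d → Fin d → ℝ) (x : Zd d) (ν : Fin d) : div₂ F x ν = ∑ μ, (F (x - unitVec μ) μ ν - F x μ ν) := rfl

/-- lit `div₃` IS (Z-a)'s `δ₃` letter, on the nose. [folklore] -/
theorem div₃_letter (H : Zd d → Fin d → Fin d → Fin d → ℝ) (x : Zd d) (μ ν : Fin d) :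
    div₃ H x μ ν = ∑ κ, (H (x - unitVec κ) κ μ ν - H x κ μ ν) := rfl

/-- lit `negLap₂` IS (Z-a)'s `−Δ ⊗ 1` letter (`(M − M(·+eⱼ)) + (M − M(·−eⱼ))` vs `2M − M(·+eⱼ) − M(·−eⱼ)`, summand by summand). [folklore] -/
theorem negLap₂_letter (F : Zd d → Fin d → Fin d → ℝ) (x : Zd d) (μ ν : Fin d) :
    negLap₂ F x μ ν = ∑ κ, (2 * F x μ ν - F (x + unitVec κ) μ ν - F (x - unitVec κ) μ ν) := by
  show ∑ κ, ((F x μ ν - F (x + unitVec κ) μ ν) + (F x μ ν - F (x - unitVec κ) μ ν)) = _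
  exact Finset.sum_congr rfl fun κ _ => by ring

/-! ## §2 Consistency by kernel: (Z-a)'s identities ARE the Literature's -/

/-- ★ **`hodge_two` = lit `div₃_d₂_add_d₁_div₂` at a point.**  (Z-a)'s Hodge identity on 2-forms, instantiated at `δF := div₂ F`, `dF := d₂ F`, states
exactly the `(x,μ,ν)` component of the Literature identity `div₃ (d₂ F) + d₁ (div₂ F) = negLap₂ F` (note the two summands appear in the order
`d₁ div₂ + div₃ d₂` on the (Z-a) side). [folklore] -/
theorem hodge_two_eq_lit (F : Zd d → Fin d → Fin d → ℝ) (x : Zd d) (μ ν : Fin d) :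
    d₁ (div₂ F) x μ ν + div₃ (d₂ F) x μ ν = negLap₂ F x μ ν := by
  rw [d₁_letter, div₃_letter, negLap₂_letter]
  exact hodge_two F (div₂ F) (d₂ F) (fun y ν' => div₂_letter F y ν') (fun y κ' μ' ν' => d₂_letter F y κ' μ' ν') x μ ν

/-- The converse reading: the Literature identity, evaluated at a point, gives (Z-a)'s `hodge_two` conclusion for the lit operators — so the two
files prove the SAME statement (one source of truth). [folklore] -/
theorem hodge_two_of_lit (F : Zd d → Fin d → Fin d → ℝ) (x : Zd d) (μ ν : Fin d) :
    ((div₂ F (x + unitVec μ) ν - div₂ F x ν) - (div₂ F (x + unitVec ν) μ - div₂ F x μ)) + ∑ κ, (d₂ F (x - unitVec κ) κ μ ν - d₂ F x κ μ ν)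
      = ∑ κ, (2 * F x μ ν - F (x + unitVec κ) μ ν - F (x - unitVec κ) μ ν) := by
  have h := congrFun (congrFun (congrFun
    (Literature.MathematicalPhysics.QuantumFieldTheory.LatticeChain.div₃_d₂_add_d₁_div₂ (A := ℝ) F) x) μ) ν
  rw [Pi.add_apply, Pi.add_apply, Pi.add_apply, add_comm] at h
  rw [d₁_letter, div₃_letter, negLap₂_letter] at h
  exact h

/-- ★ **`dTwo_curl_eq_zero` = lit `d₂_d₁` at a point.** [folklore] -/
theorem dTwo_curl_eq_zero_eq_lit (a : Zd d → Fin d → ℝ) (x : Zd d) (κ μ ν : Fin d) : d₂ (d₁ a) x κ μ ν = 0 := by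
  rw [d₂_letter]
  exact dTwo_curl_eq_zero a (d₁ a) (fun y μ' ν' => d₁_letter a y μ' ν') x κ μ ν

/-- The converse reading from the Literature: `d₂ (d₁ a) = 0` as functions (✓`LatticeForm.d₂_d₁`), hence pointwise. [folklore] -/
theorem dTwo_curl_eq_zero_of_lit (a : Zd d → Fin d → ℝ) (x : Zd d) (κ μ ν : Fin d) : d₂ (d₁ a) x κ μ ν = 0 := by
  have h := Literature.MathematicalPhysics.QuantumFieldTheory.LatticeForm.d₂_d₁ (A := ℝ) a
  exact congrFun (congrFun (congrFun (congrFun h x) κ) μ) ν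

/-! ## §3 The Literature operators satisfy (Z-a)'s new rows -/

/-- **Adjointness `Σ (div₃ ψ)·F = Σ ψ·∇F` on a box** for the lit operator `div₃` and a 3-form `ψ` vanishing off `Q_{R−1}(z)` (= (Z-a)
✓`sum_deltaThree_mul_of_support` at `δ₃ := div₃`). [folklore] -/
theorem sum_div₃_mul_of_support (ψ : Zd d → Fin d → Fin d → Fin d → ℝ) (F : Zd d → Fin d → Fin d → ℝ) (z : Zd d) (R : ℤ)
    (hψ : ∀ y ∉ box z (R - 1), ∀ κ μ ν, ψ y κ μ ν = 0) :
    ∑ y ∈ box z R, ∑ μ, ∑ ν, div₃ ψ y μ ν * F y μ ν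
      = ∑ y ∈ box z R, ∑ κ, ∑ μ, ∑ ν, ψ y κ μ ν * (F (y + unitVec κ) μ ν - F y μ ν) := by
  simp only [div₃_letter]
  exact sum_deltaThree_mul_of_support ψ F z R hψ

/-- ★ **The bulk term vanishes, lit operators**: for a totally antisymmetric 3-form `ψ` vanishing off `Q_{R−1}(z)` and a 2-form `F` with lit `d₂ F = 0` on
`Q_{R−1}(z)`: `Σ_{y ∈ Q_R(z)} Σ_{μν} (div₃ ψ)(y,μ,ν)·F(y,μ,ν) = 0` (= (Z-a) ✓`sum_deltaThree_mul_eq_zero_of_dTwo_eq_zero`). [folklore] -/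
theorem sum_div₃_mul_eq_zero_of_d₂_eq_zero (ψ : Zd d → Fin d → Fin d → Fin d → ℝ) (F : Zd d → Fin d → Fin d → ℝ) (z : Zd d) (R : ℤ)
    (hanti₁ : ∀ x κ μ ν, ψ x μ κ ν = -ψ x κ μ ν) (hanti₂ : ∀ x κ μ ν, ψ x κ ν μ = -ψ x κ μ ν)
    (hψ : ∀ y ∉ box z (R - 1), ∀ κ μ ν, ψ y κ μ ν = 0) (hclosed : ∀ y ∈ box z (R - 1), ∀ κ μ ν, d₂ F y κ μ ν = 0) :
    ∑ y ∈ box z R, ∑ μ, ∑ ν, div₃ ψ y μ ν * F y μ ν = 0 := by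
  simp only [div₃_letter]
  exact sum_deltaThree_mul_eq_zero_of_dTwo_eq_zero ψ F (d₂ F) z R (fun y κ' μ' ν' => d₂_letter F y κ' μ' ν') hanti₁ hanti₂ hψ hclosed

end Summit.QuantumFields.YangMills.Theorems.CovariantDischargeLatticeFormsBridge

end
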